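import Literature.IUT.HodgeArakelov.BadPlaceSettingOfUnderline
import Literature.IUT.HodgeArakelov.LabelClassesOfCusps
import Literature.AnabelianGeometry.EtaleTheta.XuuCocycleNormal

/-!
# [IUTchII] Def. 2.3 (i): `Π_v ⊴ Π^±_v` for ANY `±`-tower is the normality `inclPlain(Π_v) ⊴ Π^tp_{X_v}` of the setting —
# hence, over the print-level model, it IS the arithmetic normality `Π^tp_X̲̲ ⊴ Π^tp_X̲` (hN), a theorem for the cocycle model under `μ_l ⊆ K`

S. Mochizuki, *Inter-universal Teichmüller theory II*, kurims manuscript (Dec. 2020), §2, Def. 2.3 (i) p. 67 ("`Π^±_v/Π_v ⥲ … ≅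
Gal(X̲̲_v/X_v) (≅ ℤ/lℤ)`" — in particular `Π_v` is NORMAL in `Π^±_v`) ([IUTchII] Def 2.3 (i), kurims p.67) [claim: Mochizuki2012, status: disputed]
(D-0012 claim key; series status DISPUTED — elementary transport over the typed interfaces; nothing of the series is asserted);
[EtTh] Rmk. 2.6.1 p. 40 [cite: MochizukiEtTh2009, Rmk 2.6.1 p.40].  abc-iut cell, seat abc-iut-L6-t19 gen 5 (B14 follow-up: the `hN` input of the
Rmk. 2.3.1 chain p417290 `rmk231_powers_piV_of_def23_i_indices … (hN : (W.piV.subgroupOf W.piPM).Normal)` discharged at the models).  PROOF-ONLY.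

* `PlusMinusTower.piV_subgroupOf_piPM_normal` — for EVERY tower `W : PlusMinusTower T`: `incl(P) ⊴ Π^tp_{X_v}(P)` ⇒ `Π_v ⊴ Π^±_v` inside `Π̂^cor_v`
  (`emb` injective); `TemperedCoverings.range_incl_normal` — `inclPlain(Π_v) ⊴ Π^tp_{X_v}` of the setting ⇒ `incl(P) ⊴ Π^tp_{X_v}(P)`
  (the field `corresponds`);
* over the print-level model `BadPlaceSetting.ofUnderline` (p420095; `inclPlain(Π_v) = Π^tp_X̲̲ ⊆ Π^tp_X̲`): the arithmetic normality
  hN `(C.Huu.subgroupOf (D.GtpXu l)).Normal` gives `(W.piV.subgroupOf W.piPM).Normal` for every tower (`piV_subgroupOf_piPM_normal_ofUnderline`),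
  and for abc-iut-L2-t7's cocycle model `X̲̲ = Ξ.doubleUnderline` under `μ_l ⊆ K` this is UNCONDITIONAL (p422309 `doubleUnderline_normal_of_muL`;
  `piV_subgroupOf_piPM_normal_ofCocycle`).

Nothing here takes a side on [IUTchIII] Cor. 3.12; typed ≠ proved.
-/

namespace Literature.IUT.HodgeArakelov

open Literature.AnabelianGeometry.EtaleTheta

universe u

namespace TemperedCoverings

variable {S : BadPlaceSetting.{u}} {P : TopGroup.{u}} (T : TemperedCoverings S P)

/-- **`inclPlain(Π_v) ⊴ Π^tp_{X_v}` ⇒ `incl(P) ⊴ Π^tp_{X_v}(P)`** (transport along the identifications of the field `corresponds`).  PROVED.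
([IUTchII] Prop 2.1, kurims p.65) [claim: Mochizuki2012, status: disputed] -/
theorem range_incl_normal (h : S.inclPlain.range.Normal) : T.incl.range.Normal := by
  obtain ⟨e, e', hcomm, -, -⟩ := T.corresponds
  have hc : e'.toMulEquiv.toMonoidHom.comp T.incl = S.inclPlain.comp e.toMulEquiv.toMonoidHom :=
    MonoidHom.ext fun x => hcomm x
  have hmap : T.incl.range.map e'.toMulEquiv.toMonoidHom = S.inclPlain.range := by
    rw [← MonoidHom.range_comp, hc, MonoidHom.range_comp, MonoidHom.range_eq_top.mpr e.surjective,
      ← MonoidHom.range_eq_map]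
  have hback : S.inclPlain.range.map e'.symm.toMulEquiv.toMonoidHom = T.incl.range := by
    rw [← hmap, Subgroup.map_map]
    convert Subgroup.map_id T.incl.range
    ext x
    exact e'.symm_apply_apply x
  rw [← hback]
  exact h.map _ e'.symm.surjective

end TemperedCoverings

namespace PlusMinusTower

variable {S : BadPlaceSetting.{u}} {P : TopGroup.{u}} {T : TemperedCoverings S P} (W : PlusMinusTower T)

/-- `Π_v ⊆ Π^±_v` read inside `Π^±_v` is the image of `incl(P) ⊆ Π^tp_{X_v}(P)` under the range-restriction of `emb`.  PROVED.
([IUTchII] Def 2.3 (i), kurims p.67) [claim: Mochizuki2012, status: disputed] -/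
theorem piV_subgroupOf_piPM_eq_map : W.piV.subgroupOf W.piPM = T.incl.range.map W.emb.rangeRestrict := by
  ext ⟨y, hy⟩
  simp only [Subgroup.mem_subgroupOf, Subgroup.mem_map, MonoidHom.mem_range, MonoidHom.coe_comp, Function.comp_apply]
  constructor
  · rintro ⟨x, rfl⟩
    exact ⟨T.incl x, ⟨x, rfl⟩, Subtype.ext (by rw [MonoidHom.coe_rangeRestrict])⟩
  · rintro ⟨_, ⟨x, rfl⟩, hx⟩
    exact ⟨x, by rw [← MonoidHom.coe_rangeRestrict W.emb (T.incl x), hx]⟩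

/-- **`incl(P) ⊴ Π^tp_{X_v}(P)` ⇒ `Π_v ⊴ Π^±_v`** inside `Π̂^cor_v`, for EVERY `±`-tower.  PROVED.
([IUTchII] Def 2.3 (i), kurims p.67) [claim: Mochizuki2012, status: disputed] -/
theorem piV_subgroupOf_piPM_normal (h : T.incl.range.Normal) : (W.piV.subgroupOf W.piPM).Normal := by
  rw [W.piV_subgroupOf_piPM_eq_map]
  exact h.map _ W.emb.rangeRestrict_surjective

/-- **`inclPlain(Π_v) ⊴ Π^tp_{X_v}` of the setting ⇒ `Π_v ⊴ Π^±_v` for every tower over it.**  PROVED.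
([IUTchII] Def 2.3 (i), kurims p.67) [claim: Mochizuki2012, status: disputed] -/
theorem piV_subgroupOf_piPM_normal_of_setting (h : S.inclPlain.range.Normal) : (W.piV.subgroupOf W.piPM).Normal :=
  W.piV_subgroupOf_piPM_normal (T.range_incl_normal h)

end PlusMinusTower

/-! ## The [EtTh] models -/

section Models

variable {p : ℕ} [Fact p.Prime] {D : Literature.AnabelianGeometry.EtaleTheta.ThetaSetting p} {E : D.EtaleThetaData}

/-- **Over the print-level model `X̲_v` (p420095): the arithmetic normality hN `Π^tp_X̲̲ ⊴ Π^tp_X̲` gives `Π_v ⊴ Π^±_v` for EVERY tower** — the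
`hN` input of the Rmk. 2.3.1 chain (p417290) at the model.  PROVED. ([IUTchII] Def 2.3 (i), kurims p.67) [claim: Mochizuki2012, status: disputed] -/
theorem PlusMinusTower.piV_subgroupOf_piPM_normal_ofUnderline {l : ℕ} (C : E.DoubleUnderline l) {N : ℕ+}
    (μ : D.CyclotomeMod l N) (hC : D.Compat) (hS : D.Sec2Hyps) (hl : l.Prime) (hp2 : p ≠ 2) (hpl : p ≠ l)
    (hζ : ∃ ζ : D.K, IsPrimitiveRoot ζ (4 * l)) {η : (C.thetaEnvData μ hC hS).PiYdd → MuN p N}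
    (hη : η ∈ (C.thetaEnvData μ hC hS).thetaCocycles) (hN : (C.Huu.subgroupOf (D.GtpXu l)).Normal) {P : TopGroup.{0}}
    {T : TemperedCoverings (BadPlaceSetting.ofUnderline C μ hC hS hl hp2 hpl hζ hη) P} (W : PlusMinusTower T) :
    (W.piV.subgroupOf W.piPM).Normal := by
  refine W.piV_subgroupOf_piPM_normal_of_setting ?_
  rw [BadPlaceSetting.ofUnderline_range_inclPlain]
  exact hN

/-- **Over abc-iut-L2-t7's COCYCLE MODEL `X̲̲ = Ξ.doubleUnderline` under `μ_l ⊆ K`: `Π_v ⊴ Π^±_v` for every tower, UNCONDITIONALLY**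
(hN := p422309 `doubleUnderline_normal_of_muL`; [EtTh] Rmk. 2.6.1 "suppose … that `K` contains a primitive `l`-th root of unity").  PROVED.
([IUTchII] Def 2.3 (i), kurims p.67) [claim: Mochizuki2012, status: disputed] -/
theorem PlusMinusTower.piV_subgroupOf_piPM_normal_ofCocycle {l : ℕ+}
    (Ξ : Literature.AnabelianGeometry.EtaleTheta.ThetaSetting.EtaleThetaData.XuuCocycleData E l) {N : ℕ+}
    (μ : D.CyclotomeMod l N) (hC : D.Compat) (hS : D.Sec2Hyps) (hl : (l : ℕ).Prime) (hp2 : p ≠ 2) (hpl : p ≠ l)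
    (hζ : ∃ ζ : D.K, IsPrimitiveRoot ζ (4 * (l : ℕ))) {η : (Ξ.doubleUnderline.thetaEnvData μ hC hS).PiYdd → MuN p N}
    (hη : η ∈ (Ξ.doubleUnderline.thetaEnvData μ hC hS).thetaCocycles) (μ₁ : D.CyclotomeMod 1 l)
    (hμK : ∀ ζ : MuN p l, (((ζ : (PadicAlgCl p)ˣ) : PadicAlgCl p)) ∈ D.K) {P : TopGroup.{0}}
    {T : TemperedCoverings (BadPlaceSetting.ofUnderline Ξ.doubleUnderline μ hC hS hl hp2 hpl hζ hη) P}
    (W : PlusMinusTower T) : (W.piV.subgroupOf W.piPM).Normal :=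
  W.piV_subgroupOf_piPM_normal_ofUnderline Ξ.doubleUnderline μ hC hS hl hp2 hpl hζ hη
    (Ξ.doubleUnderline_normal_of_muL μ₁ hμK)

end Models

end Literature.IUT.HodgeArakelov
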